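import Literature.MathematicalPhysics.KineticTheory.CollisionFluxUpperBound
import Literature.Analysis.FluidPDE.HardSphereCollisionRecord
import HarnessLib

/-!
# Crux `EnergyCurrentTails` (stmt-AtomisticToContinuum-9235), line `level-census-comparison`:
# the FORWARD collision window — incoming velocities are read one grid time earlier

Helper file (`--supports stmt-AtomisticToContinuum-9235`) of stub F1
`stub_rateCeiling : RateCeiling` (the collision-rate ceiling for energetic shells and tails), first
of the three files of its rung-0 certificate `stub_rateCeilingRung0`.  The rate ceiling counts
collisions by the PRE-collisional (incoming) energies of the participants, whereas the window
bookkeeping of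
`Literature/MathematicalPhysics/KineticTheory/CollisionFluxUpperBound.lean`
(`sum_collision_le_sum_window`, `exists_windowEvent`) assigns a collision to the NEXT grid time and
a backward free flight, along which only the post-collisional velocities are constant (the incoming
ones depend on the impact direction, and majorising over it loses a power of the energy).  This
file runs the same bookkeeping with the PREVIOUS grid time and a forward free flight:

* `sum_collision_pre_le_sum_window` — PATHWISE, any geometry with continuous translations and
  Hausdorff positions: once the mesh `h = τ/M` is finer than the gap of the collision times in
  `[0, τ]`, the collision at `s ∈ (kh, (k+1)h]` is preceded by free flight on `[kh, s)`
  (`IsHardSphereTrajectory.leftLim_eq_freeFlight`), so the grid configuration `γ(kh)` carries the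
  incoming velocities of the colliding pair (`ofConfig_preVel_eq_leftLim`) and reaches contact after
  the forward flight `s − kh ≤ h`; distinct collision times go to distinct grid times, whence
  `Σ_{collisions in (0,τ]} A(vᵢ⁻, vⱼ⁻) ≤ Σ_{k=0}^{M−1} Σ_{i≠j} 𝟙_{E(i,j)}(γ(kh)) A(vᵢ(kh), vⱼ(kh))`
  for every mark `A` of two velocities and every family of forward window events `E(i,j)`;
* `exists_latticeVec_add_mem_of_contact_fwd` — GEOMETRY of the forward window event on `𝕋³`: a
  lift of the relative position lies in the swept tube of `vᵢ − vⱼ` (cf. the IVT variant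
  `RateFloorNoBursts.exists_latticeVec_mem_of_wouldBe` of the file
  `…Theorems.JParityClosureRateFloorNoBurstsRung0Glue`);
* `exists_windowEvent_fwd` (registered main theorem of this file) — STATICS at rung 0: the
  forward twin of `exists_windowEvent`, `∫ 𝟙_E A(vᵢ, vⱼ) dG_N ≤ 16 ε² h ∫ ‖v − w‖ A dN(u,θ)^{⊗2}`
  for the homogeneous Gibbs law, given the canonical pair bound, a swept-tube family and the
  Haar-versus-Lebesgue inequality for minimal-image lifts (proof verbatim up to the sign of the
  relative velocity).

The expectation form, its rung-0 specialisation and the certificate are the next two files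
(`…LevelCensusPreMarkFlux`, `…LevelCensusRateCeilingRung0`).

References: C. Cercignani, R. Illner, M. Pulvirenti, *The Mathematical Theory of Dilute Gases*
(1994), App. 4.A; I. Gallagher, L. Saint-Raymond, B. Texier, *From Newton to Boltzmann* (2013),
Prop. 4.1.1.
-/

noncomputable section

open MeasureTheory Set Filter Topology Function
open scoped ENNReal InnerProductSpace BigOperators

namespace Summit.AtomisticToContinuum.HydrodynamicLimit.Theorems.EnergyCurrentTailsLevelCensus

open Literature.MathematicalPhysics.KineticTheory Literature.Analysis.FluidPDE
open Literature.Analysis.FunctionSpaces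

/-! ### Pathwise: a collision is preceded by free flight from the previous grid time -/

/-- **Pathwise window bound for marks of the INCOMING velocities.**  Let `γ` be a hard-sphere
trajectory in a geometry with continuous translations and Hausdorff positions, `τ > 0`, `M ≥ 1`,
and suppose the mesh `h = τ/M` is smaller than the gap between any two collision times in `[0, τ]`.
Let `E i j` be events containing every non-overlapping configuration `w` whose pair `(i, j)` comes
to contact after a FORWARD free flight of some duration `t ∈ [0, h]`.  Then for every mark `A` of
two velocities, the collision sum over `(0, τ]` of `A(vᵢ⁻, vⱼ⁻)` (pre-collisional velocities of the
ordered contact pairs, `reflectVel` of the post-collisional ones) is at most the grid sum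
`Σ_{k=0}^{M-1} Σ_{i≠j} 𝟙_{E i j}(γ(kh)) A(vᵢ(kh), vⱼ(kh))`: the collision at time `s ∈ (kh, (k+1)h]`
is preceded by free flight on `[kh, s)`, so `γ(kh)` carries the incoming velocities of the pair and
reaches contact after the forward flight `s − kh ≤ h` (the time-reversed bookkeeping of
`sum_collision_le_sum_window`). [folklore] -/
theorem sum_collision_pre_le_sum_window {d X : Type*} [Fintype d] [TopologicalSpace X] [T2Space X]
    {G : Geometry d X} {ε : ℝ} {n : ℕ} {γ : ℝ → Config n d X} (hγ : IsHardSphereTrajectory G ε n γ)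
    (hG : ∀ x : X, Continuous (G.translate x)) {τ : ℝ} (hτ : 0 < τ) {M : ℕ} (hM : 0 < M)
    (hgap : ∀ s ∈ collisionTimes G ε γ ∩ Icc 0 τ, ∀ s' ∈ collisionTimes G ε γ ∩ Icc 0 τ,
      s < s' → τ / M < s' - s)
    (hfin : (collisionTimes G ε γ ∩ Ioc 0 τ).Finite)
    (E : Fin n → Fin n → Set (Config n d X))
    (hE : ∀ i j, i ≠ j → ∀ w ∈ hardSphereDomain G n ε, ∀ t ∈ Icc 0 (τ / M),
      ‖G.sepVec ((freeFlight G t w i).1) ((freeFlight G t w j).1)‖ = ε → w ∈ E i j)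
    (A : EuclideanSpace ℝ d × EuclideanSpace ℝ d → ℝ≥0∞) :
    ∑ s ∈ hfin.toFinset, ∑ i, ∑ j,
        (if i ≠ j ∧ ‖G.sepVec (γ s i).1 (γ s j).1‖ = ε then
          A (reflectVel (G.sepVec (γ s i).1 (γ s j).1) ((γ s i).2, (γ s j).2)) else 0) ≤
      ∑ k ∈ Finset.range M, ∑ i, ∑ j,
        (if i ≠ j then (E i j).indicator (fun w => A ((w i).2, (w j).2)) (γ ((k : ℝ) * (τ / M)))
          else 0) := by
  classical
  set h : ℝ := τ / M with hhdef
  have hM' : (0 : ℝ) < M := by exact_mod_cast hM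
  have hh : 0 < h := div_pos hτ hM'
  have hMh : (M : ℝ) * h = τ := by rw [hhdef]; field_simp
  set S : Set ℝ := collisionTimes G ε γ ∩ Ioc 0 τ with hSdef
  have hTS : ∀ s, s ∈ hfin.toFinset ↔ s ∈ S := fun s => hfin.mem_toFinset
  have hSI : ∀ s ∈ S, s ∈ collisionTimes G ε γ ∩ Icc 0 τ := fun s hs =>
    ⟨hs.1, Ioc_subset_Icc_self hs.2⟩
  -- the grid index of a collision time: `κ s * h < s ≤ (κ s + 1) * h`
  set κ : ℝ → ℕ := fun s => ⌈s / h⌉₊ - 1 with hκ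
  have hceil1 : ∀ s ∈ S, 1 ≤ ⌈s / h⌉₊ := fun s hs =>
    Nat.one_le_iff_ne_zero.2 (Nat.pos_iff_ne_zero.1 (Nat.ceil_pos.2 (div_pos hs.2.1 hh)))
  have hκcast : ∀ s ∈ S, (κ s : ℝ) = (⌈s / h⌉₊ : ℝ) - 1 := fun s hs => by
    rw [hκ, Nat.cast_sub (hceil1 s hs), Nat.cast_one]
  have hκM : ∀ s ∈ S, κ s < M := by
    intro s hs
    have h1 : ⌈s / h⌉₊ ≤ M := Nat.ceil_le.2 (by rw [div_le_iff₀ hh, hMh]; exact hs.2.2)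
    have h2 := hceil1 s hs
    show ⌈s / h⌉₊ - 1 < M
    omega
  have hκlt : ∀ s ∈ S, (κ s : ℝ) * h < s := by
    intro s hs
    have hs0 : 0 ≤ s / h := (div_pos hs.2.1 hh).le
    have h1 : (⌈s / h⌉₊ : ℝ) < s / h + 1 := Nat.ceil_lt_add_one hs0
    have h2 : (κ s : ℝ) < s / h := by rw [hκcast s hs]; linarith
    have h3 := mul_lt_mul_of_pos_right h2 hh
    rwa [div_mul_cancel₀ _ hh.ne'] at h3
  have hκle : ∀ s ∈ S, s ≤ ((κ s : ℝ) + 1) * h := by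
    intro s hs
    have h1 : s / h ≤ (⌈s / h⌉₊ : ℝ) := Nat.le_ceil _
    have h2 : (κ s : ℝ) + 1 = (⌈s / h⌉₊ : ℝ) := by rw [hκcast s hs]; ring
    rw [h2]
    rw [div_le_iff₀ hh] at h1
    exact h1
  have hκ0 : ∀ s ∈ S, 0 ≤ (κ s : ℝ) * h := fun s _ => mul_nonneg (Nat.cast_nonneg _) hh.le
  -- no collision strictly between the grid time and `s`
  have hfreeI : ∀ s ∈ S, ∀ s' ∈ Ioo ((κ s : ℝ) * h) s, s' ∉ collisionTimes G ε γ := by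
    intro s hs s' hs' hcoll
    have hs'S : s' ∈ collisionTimes G ε γ ∩ Icc 0 τ :=
      ⟨hcoll, (hκ0 s hs).trans hs'.1.le, hs'.2.le.trans hs.2.2⟩
    have h1 := hgap s' hs'S s (hSI s hs) hs'.2
    have h2 := hκle s hs
    have h3 : ((κ s : ℝ) + 1) * h = (κ s : ℝ) * h + h := by ring
    linarith [hs'.1]
  have hleft : ∀ s ∈ S, leftLim γ s = freeFlight G (s - (κ s : ℝ) * h) (γ ((κ s : ℝ) * h)) :=
    fun s hs => hγ.leftLim_eq_freeFlight hG (hκlt s hs) (hfreeI s hs)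
  -- distinct collision times have distinct grid times
  have hinj : Set.InjOn κ (hfin.toFinset : Set ℝ) := by
    have key : ∀ s ∈ S, ∀ s' ∈ S, s < s' → κ s ≠ κ s' := by
      intro s hs s' hs' hlt heq
      have h1 := hgap s (hSI s hs) s' (hSI s' hs') hlt
      have h2 := hκle s' hs'
      have h3 := hκlt s hs
      rw [heq] at h3
      have h4 : ((κ s' : ℝ) + 1) * h = (κ s' : ℝ) * h + h := by ring
      linarith
    intro s hs s' hs' heq
    rw [Finset.mem_coe, hTS] at hs hs'
    rcases lt_trichotomy s s' with hlt | heq' | hgt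
    · exact absurd heq (key s hs s' hs' hlt)
    · exact heq'
    · exact absurd heq.symm (key s' hs' s hs hgt)
  -- the one-window functional
  set W : Config n d X → ℝ≥0∞ := fun w => ∑ i, ∑ j,
    (if i ≠ j then (E i j).indicator (fun w => A ((w i).2, (w j).2)) w else 0) with hW
  -- termwise comparison at a collision time
  have hterm : ∀ s ∈ S, (∑ i, ∑ j,
      (if i ≠ j ∧ ‖G.sepVec (γ s i).1 (γ s j).1‖ = ε then
        A (reflectVel (G.sepVec (γ s i).1 (γ s j).1) ((γ s i).2, (γ s j).2)) else 0)) ≤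
        W (γ ((κ s : ℝ) * h)) := by
    intro s hs
    rw [hW]
    refine Finset.sum_le_sum fun i _ => Finset.sum_le_sum fun j _ => ?_
    by_cases hc : i ≠ j ∧ ‖G.sepVec (γ s i).1 (γ s j).1‖ = ε
    · rw [if_pos hc, if_pos hc.1]
      set t : ℝ := s - (κ s : ℝ) * h with htdef
      have ht : t ∈ Icc 0 h := by
        refine ⟨by rw [htdef]; linarith [hκlt s hs], ?_⟩
        have h2 := hκle s hs
        have h4 : ((κ s : ℝ) + 1) * h = (κ s : ℝ) * h + h := by ring
        rw [htdef]; linarith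
      set w : Config n d X := γ ((κ s : ℝ) * h) with hwdef
      have hfl : freeFlight G t w = leftLim γ s := (hleft s hs).symm
      have hp : (i, j) ∈ contactPairs G ε (γ s) := mem_contactPairs.2 ⟨hc.1, hγ.mem s, hc.2⟩
      -- the incoming velocities are those of the grid configuration
      have hpre : reflectVel (G.sepVec (γ s i).1 (γ s j).1) ((γ s i).2, (γ s j).2) =
          ((w i).2, (w j).2) := by
        have h1 := hγ.ofConfig_preVel_eq_leftLim hp
        rw [HardSphereCollisionRecord.ofConfig_preVel] at h1
        rw [h1, ← hfl, freeFlight_apply, freeFlight_apply]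
      -- the grid configuration reaches contact after the forward flight `t`
      have hcontact : ‖G.sepVec ((freeFlight G t w i).1) ((freeFlight G t w j).1)‖ = ε := by
        rw [hfl, hγ.leftLim_apply_fst hG s i, hγ.leftLim_apply_fst hG s j]
        exact hc.2
      have hmem : w ∈ E i j := hE i j hc.1 w (hγ.mem _) t ht hcontact
      rw [indicator_of_mem hmem, hpre]
    · rw [if_neg hc]
      exact bot_le
  -- sum over collision times ≤ sum over grid times
  calc ∑ s ∈ hfin.toFinset, ∑ i, ∑ j,
        (if i ≠ j ∧ ‖G.sepVec (γ s i).1 (γ s j).1‖ = ε then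
          A (reflectVel (G.sepVec (γ s i).1 (γ s j).1) ((γ s i).2, (γ s j).2)) else 0)
      ≤ ∑ s ∈ hfin.toFinset, W (γ ((κ s : ℝ) * h)) :=
        Finset.sum_le_sum fun s hs => hterm s ((hTS s).1 hs)
    _ = ∑ k ∈ hfin.toFinset.image κ, W (γ ((k : ℝ) * h)) :=
        (Finset.sum_image (f := fun k : ℕ => W (γ ((k : ℝ) * h))) hinj).symm
    _ ≤ ∑ k ∈ Finset.range M, W (γ ((k : ℝ) * h)) := by
        refine Finset.sum_le_sum_of_subset fun k hk => ?_
        rw [Finset.mem_image] at hk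
        obtain ⟨s, hs, rfl⟩ := hk
        exact Finset.mem_range.2 (hκM s ((hTS s).1 hs))

/-! ### Geometry of the forward free flight on the torus -/

/-- **Contact within forward time `h` puts a lift of the relative position in the swept tube of
the relative velocity `vᵢ − vⱼ`.**  If `w` does not overlap at diameter `ε`, `t ∈ [0, h]`, and the
pair `(i, j)` of `freeFlight t w` is at contact, then `reprSym (xᵢ − xⱼ) + k ∈ S (vᵢ − vⱼ)` for some
`k ∈ ℤ³`, for every family `S` with the covering property `hS` of a swept-tube family (the forward
twin of `exists_latticeVec_add_mem_of_contact`; cf. the variant for an approach within `ε` during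
`(0, Δ]`, `RateFloorNoBursts.exists_latticeVec_mem_of_wouldBe`, and its `sepVec_freeFlight_fwd`).
[folklore] -/
theorem exists_latticeVec_add_mem_of_contact_fwd {N : ℕ} {ε h : ℝ} {S : V3 → Set V3}
    (hS : ∀ (u r : V3) (s : ℝ), ε ≤ ‖r‖ → s ∈ Icc 0 h → ‖r + s • u‖ = ε → r ∈ S u)
    {w : Config N (Fin 3) T3} (hw : w ∈ hardSphereDomain (Torus.geometry (Fin 3)) N ε)
    {i j : Fin N} (hij : i ≠ j) {t : ℝ} (ht : t ∈ Icc 0 h)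
    (hc : ‖(Torus.geometry (Fin 3)).sepVec ((freeFlight (Torus.geometry (Fin 3)) t w i).1)
        ((freeFlight (Torus.geometry (Fin 3)) t w j).1)‖ = ε) :
    ∃ k : Fin 3 → ℤ,
      Torus.reprSym ((w i).1 - (w j).1) + Torus.latticeVec k ∈ S ((w i).2 - (w j).2) := by
  set p : T3 := (w i).1 - (w j).1 with hp
  set q : V3 := Torus.reprSym p with hq
  set u : V3 := (w i).2 - (w j).2 with hu
  -- the separation after the forward flight: `reprSym ((xᵢ − xⱼ) + proj (t (vᵢ − vⱼ)))`
  have hsep : (Torus.geometry (Fin 3)).sepVec ((freeFlight (Torus.geometry (Fin 3)) t w i).1)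
      ((freeFlight (Torus.geometry (Fin 3)) t w j).1) = Torus.reprSym (p + Torus.proj (t • u)) := by
    simp only [freeFlight_apply, Torus.geometry_translate, Torus.geometry_sepVec, hp, hu]
    congr 1
    have hps : ∀ a b : V3, Torus.proj (a - b) = Torus.proj a - Torus.proj b := fun _ _ => rfl
    rw [smul_sub, hps]
    abel
  rw [hsep] at hc
  have h2 : Torus.proj (q + t • u) = Torus.proj (Torus.reprSym (p + Torus.proj (t • u))) := by
    rw [Torus.proj_reprSym, Torus.proj_add, hq, Torus.proj_reprSym]
  obtain ⟨k, hk⟩ := (Torus.proj_eq_proj_iff_holds (q + t • u) _).1 h2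
  refine ⟨k, hS u (q + Torus.latticeVec k) t ?_ ht ?_⟩
  · have hε : ε ≤ ‖q‖ := hw i j hij
    exact hε.trans (norm_reprSym_le_norm_add_latticeVec p k)
  · have : q + Torus.latticeVec k + t • u = q + t • u + Torus.latticeVec k := by abel
    rw [this, ← hk, hc]

/-! ### The forward one-window event and its static Gibbs bound -/

/-- **Registered main theorem `exists_windowEvent_fwd` — the forward one-window collision event and
its static Gibbs bound** (the forward twin of `exists_windowEvent`).  For `σ ≤ 1/2`, constant
profiles `a, θ > 0`, `u`, `N + 1` spheres of diameter `ε = hsDiameter σ N`, a window length `h ≥ 0`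
and labels `i ≠ j` whose canonical pair law is at most `4 ×` Haar measure, given a measurable
swept-tube family `S` (`vol (S u) ≤ 4 ε² h ‖u‖`, covering property) and the Haar-versus-Lebesgue
inequality for minimal-image lifts, there is a measurable event `E` of phase space such that
(i) every non-overlapping configuration whose pair `(i, j)` comes to contact after a FORWARD free
flight of some duration `t ∈ [0, h]` lies in `E`;
(ii) for every flow `Φ` (dummy) and every measurable weight `A` of the two velocities,
`∫ 𝟙_E(w) A(vᵢ, vⱼ) dG_N(w) ≤ 16 ε² h · ∫ ‖p.1 − p.2‖ A(p) d(N(u,θ) ⊗ N(u,θ))(p)`. [folklore] -/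
theorem exists_windowEvent_fwd : ∀ {σ : ℝ}, σ ≤ 1 / 2 → ∀ {a θ : ℝ}, 0 < a → 0 < θ →
    ∀ (u : V3) {N : ℕ} {h : ℝ}, 0 ≤ h → ∀ {i j : Fin (N + 1)}, i ≠ j →
    (∀ T : Set T3, MeasurableSet T →
      posGibbsMeasure (fun _ : T3 => (1 : ℝ)) (hsDiameter σ N) (N + 1) {x | x i - x j ∈ T} ≤
        4 * volume T) →
    ∀ {S : V3 → Set V3}, MeasurableSet {q : V3 × V3 | q.1 ∈ S q.2} →
    (∀ u, volume (S u) ≤ ENNReal.ofReal (4 * hsDiameter σ N ^ 2 * h * ‖u‖)) →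
    (∀ (u r : V3) (s : ℝ), hsDiameter σ N ≤ ‖r‖ → s ∈ Icc 0 h →
      ‖r + s • u‖ = hsDiameter σ N → r ∈ S u) →
    (∀ B : Set V3, MeasurableSet B →
      volume {x : T3 | ∃ k : Fin 3 → ℤ, Torus.reprSym x + Torus.latticeVec k ∈ B} ≤ volume B) →
    ∃ E : Set (Config (N + 1) (Fin 3) T3), MeasurableSet E ∧
      (∀ w ∈ hardSphereDomain (Torus.geometry (Fin 3)) (N + 1) (hsDiameter σ N), ∀ t ∈ Icc 0 h,
        ‖(Torus.geometry (Fin 3)).sepVec ((freeFlight (Torus.geometry (Fin 3)) t w i).1)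
            ((freeFlight (Torus.geometry (Fin 3)) t w j).1)‖ = hsDiameter σ N → w ∈ E) ∧
      ∀ (Φ : HardSphereFlow (Torus.geometry (Fin 3)) (hsDiameter σ N) (N + 1))
        (A : V3 × V3 → ℝ≥0∞), Measurable A →
        ∫⁻ w, E.indicator (fun w => A ((w i).2, (w j).2)) w
            ∂(localGibbsLaw σ (fun _ => a) (fun _ => u) (fun _ => θ) N Φ) ≤
          ENNReal.ofReal (16 * hsDiameter σ N ^ 2 * h) *
            ∫⁻ p, ENNReal.ofReal ‖p.1 - p.2‖ * A p
              ∂((gaussMeasure u θ).prod (gaussMeasure u θ)) := by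
  intro σ hσ2 a θ ha hθ u N h hh i j hij hpair S hSm hSvol hS hlift
  set ε := hsDiameter σ N with hεdef
  -- the event: some lift of the relative position lies in the tube of the relative velocity
  set ψ : (Fin 3 → ℤ) → Config (N + 1) (Fin 3) T3 → V3 × V3 := fun k w =>
    (Torus.reprSym ((w i).1 - (w j).1) + Torus.latticeVec k, (w i).2 - (w j).2) with hψ
  have hψm : ∀ k, Measurable (ψ k) := by
    intro k
    refine Measurable.prodMk ?_ ?_
    · exact (Torus.measurable_reprSym.comp
        ((measurable_pi_apply i).fst.sub (measurable_pi_apply j).fst)).add_const _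
    · exact (measurable_pi_apply i).snd.sub (measurable_pi_apply j).snd
  set E : Set (Config (N + 1) (Fin 3) T3) := ⋃ k, ψ k ⁻¹' {q : V3 × V3 | q.1 ∈ S q.2} with hE
  have hEm : MeasurableSet E := MeasurableSet.iUnion fun k => hSm.preimage (hψm k)
  refine ⟨E, hEm, ?_, ?_⟩
  · intro w hw t ht hc
    obtain ⟨k, hk⟩ := exists_latticeVec_add_mem_of_contact_fwd hS hw hij ht hc
    exact mem_iUnion.2 ⟨k, hk⟩
  intro Φ A hA
  -- sections of the tube family are measurable
  have hSu : ∀ v : V3, MeasurableSet (S v) := fun v =>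
    hSm.preimage (measurable_id.prodMk measurable_const)
  -- the position event of a fixed velocity vector
  set T : (Fin (N + 1) → V3) → Set T3 := fun v =>
    {p | ∃ k : Fin 3 → ℤ, Torus.reprSym p + Torus.latticeVec k ∈ S (v i - v j)} with hT
  have hTm : ∀ v, MeasurableSet (T v) := by
    intro v
    have : T v = ⋃ k : Fin 3 → ℤ, (fun p : T3 => Torus.reprSym p + Torus.latticeVec k) ⁻¹'
        S (v i - v j) := by
      ext p; simp only [hT, mem_setOf_eq, mem_iUnion, mem_preimage]
    rw [this]
    exact MeasurableSet.iUnion fun k => (hSu _).preimage (Torus.measurable_reprSym.add_const _)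
  have hTvol : ∀ v, volume (T v) ≤ ENNReal.ofReal (4 * ε ^ 2 * h * ‖v i - v j‖) := fun v =>
    (hlift _ (hSu _)).trans (hSvol _)
  -- the integrand and its measurability
  set F : Config (N + 1) (Fin 3) T3 → ℝ≥0∞ := E.indicator fun w => A ((w i).2, (w j).2) with hF
  have hAm : Measurable fun w : Config (N + 1) (Fin 3) T3 => A ((w i).2, (w j).2) :=
    hA.comp ((measurable_pi_apply i).snd.prodMk (measurable_pi_apply j).snd)
  have hFm : Measurable F := hAm.indicator hEm
  -- disintegrate the rung-0 law
  set Q := posGibbsMeasure (fun _ : T3 => a) ε (N + 1) with hQ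
  set Γ : Measure (Fin (N + 1) → V3) := Measure.pi fun _ => gaussMeasure u θ with hΓ
  have hlaw : localGibbsLaw σ (fun _ => a) (fun _ => u) (fun _ => θ) N Φ =
      (Q.prod Γ).map zipConfig := by
    rw [localGibbsLaw_eq, localGibbsMeasure_rung0_eq_map σ ha.le hθ u N]
  haveI : IsProbabilityMeasure Q :=
    isProbabilityMeasure_posGibbsMeasure continuous_const (fun _ => ha) hσ2 N
  haveI : IsProbabilityMeasure Γ := by rw [hΓ]; infer_instance
  have hsec : ∀ v : Fin (N + 1) → V3,
      ∫⁻ x, F (zipConfig (x, v)) ∂Q ≤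
        A (v i, v j) * ENNReal.ofReal (16 * ε ^ 2 * h * ‖v i - v j‖) := by
    intro v
    have hle : ∀ x, F (zipConfig (x, v)) ≤ {x : Fin (N + 1) → T3 | x i - x j ∈ T v}.indicator
        (fun _ => A (v i, v j)) x := by
      intro x
      by_cases hx : zipConfig (x, v) ∈ E
      · have hx' : x ∈ {x : Fin (N + 1) → T3 | x i - x j ∈ T v} := by
          obtain ⟨k, hk⟩ := mem_iUnion.1 hx
          exact ⟨k, by simpa only [hψ, zipConfig_apply, mem_preimage, mem_setOf_eq] using hk⟩
        rw [hF, indicator_of_mem hx, indicator_of_mem hx']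
        simp only [zipConfig_apply, le_refl]
      · rw [hF, indicator_of_notMem hx]
        exact bot_le
    calc ∫⁻ x, F (zipConfig (x, v)) ∂Q
        ≤ ∫⁻ x, {x : Fin (N + 1) → T3 | x i - x j ∈ T v}.indicator (fun _ => A (v i, v j)) x ∂Q :=
          lintegral_mono hle
      _ ≤ A (v i, v j) * Q {x | x i - x j ∈ T v} := lintegral_indicator_const_le _ _
      _ ≤ A (v i, v j) * (4 * volume (T v)) := by
          have hQ' : Q {x | x i - x j ∈ T v} ≤ 4 * volume (T v) := by
            rw [hQ, posGibbsMeasure_const_eq_one ha]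
            exact hpair _ (hTm v)
          gcongr
      _ ≤ A (v i, v j) * (4 * ENNReal.ofReal (4 * ε ^ 2 * h * ‖v i - v j‖)) := by
          gcongr
          exact hTvol v
      _ = A (v i, v j) * ENNReal.ofReal (16 * ε ^ 2 * h * ‖v i - v j‖) := by
          rw [← ENNReal.ofReal_ofNat 4, ← ENNReal.ofReal_mul (by norm_num)]
          congr 2
          ring
  calc ∫⁻ w, F w ∂(localGibbsLaw σ (fun _ => a) (fun _ => u) (fun _ => θ) N Φ)
      = ∫⁻ pr, F (zipConfig pr) ∂(Q.prod Γ) := by rw [hlaw, lintegral_map hFm measurable_zipConfig]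
    _ = ∫⁻ v, ∫⁻ x, F (zipConfig (x, v)) ∂Q ∂Γ :=
        lintegral_prod_symm _ (hFm.comp measurable_zipConfig).aemeasurable
    _ ≤ ∫⁻ v, A (v i, v j) * ENNReal.ofReal (16 * ε ^ 2 * h * ‖v i - v j‖) ∂Γ := lintegral_mono hsec
    _ = ∫⁻ p, A p * ENNReal.ofReal (16 * ε ^ 2 * h * ‖p.1 - p.2‖)
          ∂((gaussMeasure u θ).prod (gaussMeasure u θ)) := by
        rw [hΓ]
        exact lintegral_pi_pair (gaussMeasure u θ) hij
          (f := fun p : V3 × V3 => A p * ENNReal.ofReal (16 * ε ^ 2 * h * ‖p.1 - p.2‖))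
          (hA.mul (by fun_prop))
    _ = ENNReal.ofReal (16 * ε ^ 2 * h) *
          ∫⁻ p, ENNReal.ofReal ‖p.1 - p.2‖ * A p ∂((gaussMeasure u θ).prod (gaussMeasure u θ)) := by
        rw [← lintegral_const_mul' _ _ ENNReal.ofReal_ne_top]
        refine lintegral_congr fun p => ?_
        rw [ENNReal.ofReal_mul (by positivity)]
        ring

end Summit.AtomisticToContinuum.HydrodynamicLimit.Theorems.EnergyCurrentTailsLevelCensus

end
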